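import Summits.BirchSwinnertonDyer.Rank1Residual.Additive.KatoDescentGlobalKummerSaturation
import HarnessLib

set_option autoImplicit false

/-!
# KUMMER SATURATION ON THE ROWS: `H¹(ℤ[1/p], T_pW) ⊆ ℤ_p · κ_∞(P)` in rank one, and `v(log_ω P) ≤ v₀ ≤ v(log_ω P) + c`
# (seat `bsd-cm-prr-ty1` g10, cell `bsd-cm`; theorems only: no definition, no named fact, no instance, no `sorry`)

Sequel of `KatoDescentGlobalKummerSaturation` (§§1–2: `p^m • z = μ • κ_∞(Q)` ⟹ `z = ν • κ_∞(P)`).  On the rows of stub 3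
(`W` globally minimal, `rank W(ℚ) = 1` generated by `P` modulo torsion, `Ш[p^∞]` finite, `p ∤ #W(ℚ)_tors`):
* `exists_eq_smul_kummerTate_of_mem_integralH1`: every `z ∈ integralH1 (tateRep W p) p ⊤` is `ν • κ_∞(P)` for ONE `ν ∈ ℤ_p` —
  potss (R1-a) «`𝔥 = H¹(ℤ[1/p], j_*T) ⊆ ℤ_p κ(P)`» (the relation `p^m • z = μ • p^c κ_∞(P)` comes from cn100's (R1)
  `exists_smul_add_smul_eq_zero_of_mem_integralH1`, brick (a′) `p^c • κ_∞(P) ∈ A`, torsion-freeness of `H¹(ℚ, T_pW)` and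
  `κ_∞(P) ≠ 0`); the same at the bottom layer of a `ℤ_p`-extension datum (`exists_layerZeroToTop_eq_smul_kummerTate`);
* `exists_kummerLog_eq_mul_padicLogLocal`: every value of a Kummer-log functional `φ` on `A` is `ν · log_ω P`;
* **`valuation_padicLogLocal_le`: `v(log_ω P) ≤ v₀`** for the normalisation `φ(A) = p^{v₀}ℤ_p` of the COUNT displays, and with
  brick (b) (`le_add_valuation_padicLogLocal`) **`v(log_ω P) ≤ v₀ ≤ v(log_ω P) + c`** (`valuation_padicLogLocal_le_and_le`): the
  exponent `a := v₀ − v(log_ω P)` of (R1-a) lies in `[0, c]`, `c` the uniform Tamagawa exponent of brick (a′).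

HONEST FRAMING: bookkeeping over tree theorems; no named fact, no definition; nothing about `𝐇²`, the fine Selmer group, the
Perrin-Riou formula or BSD is proved.  PARTITION: RANK axis × Kato–Perrin-Riou road (stub 3 of 19945/19223); closes no item.
References: [Kato2004Asterisque] §14.1, §14.18; [BlochKato1990] Def. 3.10, Ex. 3.11; [Rubin2000] App. B Prop. B.2.3;
[SilvermanAEC2009] VIII.§2, IV.6.4, VII.6.3.
-/

noncomputable section

open scoped Classical NumberField ContRepresentation

open WeierstrassCurve Field IsDedekindDomain NumberField CategoryTheory Literature.NumberTheory.EllipticCurves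
  Literature.NumberTheory.EllipticCurves.Kato2004 Literature.NumberTheory.GaloisRepresentations
  Literature.NumberTheory.EllipticCurves.Kato2004.EulerSystemValues
  Summit.BirchSwinnertonDyer.BirchSwinnertonDyer.Theorems.IntegralH1LayerZeroTop
  Summit.BirchSwinnertonDyer.BirchSwinnertonDyer.Theorems.CongruentShaFreeCutIntegralH1RankLeOne
open WeierstrassCurve (geomPoints geomTorsion galH1Torsion kummerMapTorsion torsionH1ToH1)

universe u

namespace Summit.BirchSwinnertonDyer.Rank1Residual.Additive.GlobalKummer

/-! ## §3 The rows: every integral class is a `p`-adic multiple of `κ_∞(P)`; `v(log_ω P) ≤ v₀ ≤ v(log_ω P) + c` -/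

section Rows

variable (W : WeierstrassCurve ℚ) [W.IsElliptic] (p : ℕ) [Fact p.Prime] [ContinuousSMul ℤ_[p] (W.tateModule p)]

/-- **The `T_p`-adic Kummer class of a point of infinite order is non-zero** (`W` globally minimal): it carries the Kummer
logarithm `log_ω P ≠ 0` (`hasLocPKummerLog_of_forall_eq`, `padicLogLocal_map_ne_zero`), while the zero class has
logarithm `0` only. [cite: Kato2004Asterisque, §14.1 (p. 235)] [cite: SilvermanAEC2009, IV.6.4 and VII.6.3] -/
theorem kummerTate_ne_zero [W.IsGloballyMinimal] {P : W.toAffine.Point} (hP : ¬ IsOfFinAddOrder P)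
    {x : H1 (tateRep W p) ⊤}
    (hx : ∀ j : ℕ,
      (ofTopSubgroup (W.torsionGaloisModule ((p : ℤ) ^ j)).toTopRep 1).hom (reduceH1Pk W p j ⊤ x) =
        kummerMapTorsion W ((p : ℤ) ^ j) (zsmul_pow_surjective W p j) P) :
    x ≠ 0 := by
  intro h0
  have hlog := hasLocPKummerLog_of_forall_eq W p (zsmul_pow_surjective W p) hx
  rw [h0] at hlog
  exact LocPKummer.padicLogLocal_map_ne_zero W p hP
    (ContraCount.HasLocPKummerLog.unique W p hlog (LocPKummer.hasLocPKummerLog_zero W p))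

/-- **THE ROWS, at `⊤`: every class of `H¹(ℤ[1/p], T_pW) = integralH1 (tateRep W p) p ⊤` is `ν • κ_∞(P)` for ONE
`ν ∈ ℤ_p`** (`W` globally minimal, `rank W(ℚ) = 1` generated by `P` modulo torsion, `Ш[p^∞]` finite, `p ∤ #W(ℚ)_tors`).
cn100's (R1) dependence `a • z + b • (p^c • κ_∞ P) = 0` (`exists_smul_add_smul_eq_zero_of_mem_integralH1`, with brick (a′)
`p^c • κ_∞(P) ∈ A`), `H¹(ℚ, T_pW)` torsion-free (`noZeroSMulDivisors_H1_of_fixedPoints`, `W[p]^{Γ_ℚ} = 0`), `κ_∞(P) ≠ 0`,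
so `a = u p^m ≠ 0` and `p^m • z = μ • κ_∞(P)`; then §2.  This is potss (R1-a) «`𝔥 ⊆ ℤ_p κ(P)`».
[cite: Kato2004Asterisque, §14.1 (p. 235) and §14.18 (p. 244)] [cite: Rubin2000, App. B Prop. B.2.3] [cite: BlochKato1990, Ex. 3.11] -/
theorem exists_eq_smul_kummerTate_of_mem_integralH1 [W.IsGloballyMinimal] (hrank : W.mordellWeilRank = 1)
    (hsha : Finite (AddCommGroup.primaryComponent W.sha p)) (htors : ¬ p ∣ W.torsionOrder) {P : W.toAffine.Point}
    (hgen : ∀ R : W.toAffine.Point, ∃ n : ℤ, IsOfFinAddOrder (R - n • P)) {x : H1 (tateRep W p) ⊤}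
    (hx : ∀ j : ℕ,
      (ofTopSubgroup (W.torsionGaloisModule ((p : ℤ) ^ j)).toTopRep 1).hom (reduceH1Pk W p j ⊤ x) =
        kummerMapTorsion W ((p : ℤ) ^ j) (zsmul_pow_surjective W p j) P)
    {z : H1 (tateRep W p) ⊤} (hz : z ∈ integralH1 (tateRep W p) p ⊤) :
    ∃ ν : ℤ_[p], z = ν • x := by
  have hp : p.Prime := Fact.out
  haveI := hsha
  haveI : NoZeroSMulDivisors ℤ_[p] (H1 (tateRep W p) ⊤) :=
    LocPKummer.noZeroSMulDivisors_H1_of_fixedPoints W p ⊤ fun T hT ↦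
      LocPKummer.geomTorsion_eq_zero_of_forall_smul_eq_of_not_dvd_torsionOrder W p htors T fun g ↦
        hT ⟨g, Subgroup.mem_top g⟩
  have hP : ¬ IsOfFinAddOrder P := ContraCount.not_isOfFinAddOrder_of_generates hrank hgen
  have hx0 : x ≠ 0 := kummerTate_ne_zero W p hP hx
  -- brick (a′): `p^c • x ∈ A`
  obtain ⟨c, hc⟩ := exists_pow_smul_mem_integralH1_of_forall_eq W p (zsmul_pow_surjective W p)
  have hcx : p ^ c • x ∈ integralH1 (tateRep W p) p ⊤ := hc hx
  -- cn100 (R1): a dependence relation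
  obtain ⟨a, b, hab, hrel⟩ := exists_smul_add_smul_eq_zero_of_mem_integralH1 W p hrank z (p ^ c • x) hz hcx
  have ha : a ≠ 0 := by
    intro ha
    rw [ha, zero_smul, zero_add, ← Nat.cast_smul_eq_nsmul ℤ_[p], smul_smul, smul_eq_zero] at hrel
    rcases hrel with hb | hx'
    · exact (hab.resolve_left (not_not.mpr ha))
        ((mul_eq_zero.mp hb).resolve_right (Nat.cast_ne_zero.mpr (pow_ne_zero c hp.ne_zero)))
    · exact hx0 hx'
  -- `a = u p^m`, so `p^m • z = μ • x`
  set m : ℕ := a.valuation with hm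
  set u : ℤ_[p]ˣ := PadicInt.unitCoeff ha with hu
  have hau : a = (u : ℤ_[p]) * (p : ℤ_[p]) ^ m := PadicInt.unitCoeff_spec ha
  have hz' : p ^ m • z = ((u⁻¹ : ℤ_[p]ˣ) : ℤ_[p]) • ((-(b * (p : ℤ_[p]) ^ c)) • x) := by
    have h1 : ((u : ℤ_[p]) * (p : ℤ_[p]) ^ m) • z = (-(b * (p : ℤ_[p]) ^ c)) • x := by
      rw [← hau, neg_smul, eq_neg_iff_add_eq_zero, mul_smul, ← Nat.cast_pow, Nat.cast_smul_eq_nsmul]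
      exact hrel
    rw [← h1, smul_smul, ← mul_assoc, Units.inv_mul, one_mul, ← Nat.cast_pow, Nat.cast_smul_eq_nsmul]
  rw [smul_smul] at hz'
  exact exists_eq_smul_of_pow_smul_eq W p htors hgen hx hx hz'

/-- **THE ROWS, at the bottom layer of a `ℤ_p`-extension datum** (the typing of the COUNT displays,
`A = integralH1 (tateRep W p) p (κ.layerSubgroup 0)` moved to `⊤` by `layerZeroToTop`): every `z ∈ A` has
`layerZeroToTop z = ν • κ_∞(P)` for ONE `ν ∈ ℤ_p`. [cite: Kato2004Asterisque, §14.1 (p. 235) and §14.14 (14.14.1) (p. 243)] -/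
theorem exists_layerZeroToTop_eq_smul_kummerTate [W.IsGloballyMinimal] (κ : ZpExtension ℚ p)
    (hrank : W.mordellWeilRank = 1) (hsha : Finite (AddCommGroup.primaryComponent W.sha p))
    (htors : ¬ p ∣ W.torsionOrder) {P : W.toAffine.Point}
    (hgen : ∀ R : W.toAffine.Point, ∃ n : ℤ, IsOfFinAddOrder (R - n • P)) {x : H1 (tateRep W p) ⊤}
    (hx : ∀ j : ℕ,
      (ofTopSubgroup (W.torsionGaloisModule ((p : ℤ) ^ j)).toTopRep 1).hom (reduceH1Pk W p j ⊤ x) =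
        kummerMapTorsion W ((p : ℤ) ^ j) (zsmul_pow_surjective W p j) P)
    (z : integralH1 (tateRep W p) p (κ.layerSubgroup 0)) :
    ∃ ν : ℤ_[p], layerZeroToTop W p κ (z : H1 (tateRep W p) (κ.layerSubgroup 0)) = ν • x := by
  obtain ⟨e, he⟩ := exists_integralH1LayerZeroEquivTop W p κ
  have hz : layerZeroToTop W p κ (z : H1 (tateRep W p) (κ.layerSubgroup 0)) ∈ integralH1 (tateRep W p) p ⊤ := by
    rw [← he z]; exact (e z).2
  exact exists_eq_smul_kummerTate_of_mem_integralH1 W p hrank hsha htors hgen hx hz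

/-- **Every value of a Kummer-log functional on `A` is a `ℤ_p`-multiple of `log_ω P`** on the rows: `φ z = ν · log_ω P`
with `layerZeroToTop z = ν • κ_∞(P)` (`HasLocPKummerLog` is `ℤ_p`-linear and unique: `hasLocPKummerLog_smul_eq`;
`κ_∞(P)` has logarithm `log_ω P`). [cite: BlochKato1990, Def. 3.10 and Ex. 3.11] [cite: Kato2004Asterisque, §14.18 (p. 244)] -/
theorem exists_kummerLog_eq_mul_padicLogLocal [W.IsGloballyMinimal] (κ : ZpExtension ℚ p)
    (hrank : W.mordellWeilRank = 1) (hsha : Finite (AddCommGroup.primaryComponent W.sha p))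
    (htors : ¬ p ∣ W.torsionOrder) {P : W.toAffine.Point}
    (hgen : ∀ R : W.toAffine.Point, ∃ n : ℤ, IsOfFinAddOrder (R - n • P))
    (φ : integralH1 (tateRep W p) p (κ.layerSubgroup 0) →ₗ[ℤ_[p]] ℚ_[p])
    (hφ : ∀ x : integralH1 (tateRep W p) p (κ.layerSubgroup 0),
      HasLocPKummerLog W p (layerZeroToTop W p κ (x : H1 (tateRep W p) (κ.layerSubgroup 0))) (φ x))
    (z : integralH1 (tateRep W p) p (κ.layerSubgroup 0)) :
    ∃ ν : ℤ_[p], φ z = (ν : ℚ_[p]) *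
      padicLogLocal W p (Affine.Point.map (W' := W.toAffine) (S := ℚ) (Algebra.ofId ℚ ℚ_[p]) P) := by
  obtain ⟨x, hx⟩ := exists_forall_ofTopSubgroup_reduceH1Pk_eq_kummerMapTorsion W p (zsmul_pow_surjective W p) P
  obtain ⟨ν, hν⟩ := exists_layerZeroToTop_eq_smul_kummerTate W p κ hrank hsha htors hgen hx z
  refine ⟨ν, ?_⟩
  have h := ContraCount.hasLocPKummerLog_smul_eq W p (c₁ := 1) (c₂ := ν) (by rw [one_smul, hν]) (hφ z)
    (hasLocPKummerLog_of_forall_eq W p (zsmul_pow_surjective W p) hx)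
  simpa using h

/-- **`v(log_ω P) ≤ v₀`** on the rows, for the normalisation `φ(A) = p^{v₀} ℤ_p` of a Kummer-log functional: `p^{v₀} = φ z =
ν · log_ω P` for some `z ∈ A`, `ν ∈ ℤ_p`. This is the SATURATION half of potss (R1-a) read on the display's `v₀`: with brick (b)
(`le_add_valuation_padicLogLocal`: `v₀ ≤ c + v(log_ω P)`) the defect `a := v₀ − v(log_ω P)` lies in `[0, c]`.
[cite: Kato2004Asterisque, §14.18 (p. 244)] [cite: BlochKato1990, Ex. 3.11] -/
theorem valuation_padicLogLocal_le [W.IsGloballyMinimal] (κ : ZpExtension ℚ p)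
    (hrank : W.mordellWeilRank = 1) (hsha : Finite (AddCommGroup.primaryComponent W.sha p))
    (htors : ¬ p ∣ W.torsionOrder) {P : W.toAffine.Point}
    (hgen : ∀ R : W.toAffine.Point, ∃ n : ℤ, IsOfFinAddOrder (R - n • P))
    (φ : integralH1 (tateRep W p) p (κ.layerSubgroup 0) →ₗ[ℤ_[p]] ℚ_[p])
    (hφ : ∀ x : integralH1 (tateRep W p) p (κ.layerSubgroup 0),
      HasLocPKummerLog W p (layerZeroToTop W p κ (x : H1 (tateRep W p) (κ.layerSubgroup 0))) (φ x))
    {v₀ : ℤ} (hv₀ : LinearMap.range φ = Submodule.span ℤ_[p] {((p : ℚ_[p]) ^ v₀)}) :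
    (padicLogLocal W p (Affine.Point.map (W' := W.toAffine) (S := ℚ) (Algebra.ofId ℚ ℚ_[p]) P)).valuation ≤ v₀ := by
  have hp : p.Prime := Fact.out
  have hmem : ((p : ℚ_[p]) ^ v₀) ∈ LinearMap.range φ := by
    rw [hv₀]; exact Submodule.mem_span_singleton_self _
  obtain ⟨z, hz⟩ := hmem
  obtain ⟨ν, hν⟩ := exists_kummerLog_eq_mul_padicLogLocal W p κ hrank hsha htors hgen φ hφ z
  rw [hz] at hν
  have hp0 : (p : ℚ_[p]) ≠ 0 := Nat.cast_ne_zero.mpr hp.ne_zero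
  have hpv : ((p : ℚ_[p]) ^ v₀) ≠ 0 := zpow_ne_zero _ hp0
  have hν0 : (ν : ℚ_[p]) ≠ 0 := by
    intro h; rw [h, zero_mul] at hν; exact hpv hν
  have hlog0 : padicLogLocal W p (Affine.Point.map (W' := W.toAffine) (S := ℚ) (Algebra.ofId ℚ ℚ_[p]) P) ≠ 0 := by
    intro h; rw [h, mul_zero] at hν; exact hpv hν
  have hval : v₀ = (ν : ℚ_[p]).valuation +
      (padicLogLocal W p (Affine.Point.map (W' := W.toAffine) (S := ℚ) (Algebra.ofId ℚ ℚ_[p]) P)).valuation := by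
    rw [← Padic.valuation_mul hν0 hlog0, ← hν, Padic.valuation_zpow, Padic.valuation_p, mul_one]
  rw [hval]
  exact le_add_of_nonneg_left (PadicInt.valuation_coe_nonneg)

/-- **(R1-a) on the display: `v(log_ω P) ≤ v₀ ≤ v(log_ω P) + c`**, `c` the uniform Tamagawa exponent of brick (a′)/(b)
(`exists_integralH1_kummerTate`): the lower bound is saturation (this file), the upper bound is brick (b)
(`le_add_valuation_padicLogLocal`). [cite: Kato2004Asterisque, §14.18 (p. 244)] [cite: BlochKato1990, Ex. 3.11] -/
theorem valuation_padicLogLocal_le_and_le [W.IsGloballyMinimal] (κ : ZpExtension ℚ p)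
    (hrank : W.mordellWeilRank = 1) (hsha : Finite (AddCommGroup.primaryComponent W.sha p))
    (htors : ¬ p ∣ W.torsionOrder) {P : W.toAffine.Point}
    (hgen : ∀ R : W.toAffine.Point, ∃ n : ℤ, IsOfFinAddOrder (R - n • P))
    (φ : integralH1 (tateRep W p) p (κ.layerSubgroup 0) →ₗ[ℤ_[p]] ℚ_[p])
    (hφ : ∀ x : integralH1 (tateRep W p) p (κ.layerSubgroup 0),
      HasLocPKummerLog W p (layerZeroToTop W p κ (x : H1 (tateRep W p) (κ.layerSubgroup 0))) (φ x))
    {v₀ : ℤ} (hv₀ : LinearMap.range φ = Submodule.span ℤ_[p] {((p : ℚ_[p]) ^ v₀)})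
    {c : ℕ} {y : W.toAffine.Point →+ integralH1 (tateRep W p) p (κ.layerSubgroup 0)}
    (hy : ∀ P : W.toAffine.Point,
      HasLocPKummerLog W p (layerZeroToTop W p κ (y P : H1 (tateRep W p) (κ.layerSubgroup 0)))
        ((p : ℚ_[p]) ^ c * padicLogLocal W p (Affine.Point.map (W' := W.toAffine) (S := ℚ) (Algebra.ofId ℚ ℚ_[p]) P))) :
    (padicLogLocal W p (Affine.Point.map (W' := W.toAffine) (S := ℚ) (Algebra.ofId ℚ ℚ_[p]) P)).valuation ≤ v₀ ∧
      v₀ ≤ (c : ℤ) + (padicLogLocal W p (Affine.Point.map (W' := W.toAffine) (S := ℚ) (Algebra.ofId ℚ ℚ_[p]) P)).valuation :=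
  ⟨valuation_padicLogLocal_le W p κ hrank hsha htors hgen φ hφ hv₀,
    LocPKummer.le_add_valuation_padicLogLocal W p φ hφ hv₀ hy
      (ContraCount.not_isOfFinAddOrder_of_generates hrank hgen)⟩

end Rows

end Summit.BirchSwinnertonDyer.Rank1Residual.Additive.GlobalKummer
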